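import Literature.Probability.RandomPlanarGeometry.HexSAWRotSurfaceYcLimitAllY
import Literature.Probability.RandomPlanarGeometry.HexSAWArmchairWallBridgeRate
import Literature.Probability.RandomPlanarGeometry.HexSAWArmchairSlabLocality
import HarnessLib

/-!
# Beaton's `μ(y)` IS the armchair wall-bridge rate: `lim_n C⁺_n(y)^{1/n} = β_rot(y)` and `μ ≤ β_rot(y)` for EVERY `y > 0`

Topic `Literature/Probability/RandomPlanarGeometry` (lane «pcv-sawmu», door «HEX-YC-ROT-LIMIT-ALL-Y», capstone of rider H; combines
`HexSAWRotSurfaceYcLimitAllY.lean` — `HV.tendsto_rotHpCoeff_rpow : C⁺_n(y)^{1/n} → rotSurfaceMu y = max (armRate y) μ`,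
`rotSurfaceMu_eq_iff` —, `HexSAWArmchairUnfolding.lean` — `archBound_holds` — and `HexSAWArmchairWallBridgeRate.lean` —
`hexConnectiveConstant_le_armRate_of_archBound`).

Sources.  N. R. Beaton, J. Phys. A 47 (2014) 075003, arXiv:1210.0274v3, §3.1, Proposition 7 and its proof (p. 12: "the proof of
[Hammersley–Torrie–Whittington] can be applied mutatis mutandis to show that `μ(y) = lim_{n→∞} U_n^+(y)^{1/n}` exists and satisfies the
properties given in the proposition"); J. M. Hammersley, G. M. Torrie, S. G. Whittington, J. Phys. A 15 (1982) 539, §2;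
H. Duminil-Copin, S. Smirnov, Ann. of Math. 175 (2012) 1653, Theorem 1.

## Main statements (namespace `…SAW.HV`; no hypotheses beyond `0 < y`)

* `hexConnectiveConstant_le_armRate : μ ≤ β_rot(y)`; `rotSurfaceMu_eq_armRate_of_pos : rotSurfaceMu y = armRate y`;
* **`tendsto_rotHpCoeff_rpow_armRate : C⁺_n(y)^{1/n} → β_rot(y)`** — Proposition 7 sentence 1 with Beaton's own value, the rate of the
  unfolded (terminally attached) walks;
* `armRate_eq_hexConnectiveConstant_iff : β_rot(y) = μ ↔ y ≤ y†` — the armchair wall-bridge free energy equals `log μ` exactly in the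
  desorbed regime (the strict form `μ < β_rot(y) ↔ y† < y` is `hexConnectiveConstant_lt_armRate_iff` of
  `HexSAWRotSurfaceYcLimitAllY.lean`, used below by name).

EDITION NOTE (ed.2).  ed.1 also carried a convenience alias `hexConnectiveConstant_lt_armRate_iff'` whose statement is textually that of
the tree theorem `hexConnectiveConstant_lt_armRate_iff` (`HexSAWRotSurfaceYcLimitAllY.lean`); the alias is dropped here (statement-level
duplicate of a landed theorem), nothing else changed.

## ONE-CAR EDITION (lead g14 r18 general rule): Part 2 = the former module «ROT-STRIP-LOCALITY-ALL-Y» `HexSAWRotStripLocalityAllY.lean`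
(a-p6 g10, 652deb315513d7de), bodies VERBATIM, appended below Part 1 so that the chain H′ → J waits on ONE olean
(`HexSAWArmchairWallBridgeRate`) instead of two.  Its header, verbatim:

> # Beaton 2014, Proposition 9, second sentence, for EVERY `y > 0`: `μ_H(y) → μ(y)` as `H → ∞` (strips of the rotated honeycomb lattice)
>
> Topic `Literature/Probability/RandomPlanarGeometry` (lane «pcv-sawmu», door «HEX-YC-ROT-LIMIT-ALL-Y», capstone of riders I/I'; combines
> `HexSAWArmchairSlabLocality.lean` — `tendsto_slabMuY_of_archBound : ArchBound y → μ ≤ β_rot(y) → μ_H(y) → β_rot(y)` — with the two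
> inputs discharged in the tree/lane: `archBound_holds` (`HexSAWArmchairUnfolding.lean`) and `HV.hexConnectiveConstant_le_armRate`
> (`HexSAWRotSurfaceArmRate.lean`), and with `HV.rotSurfaceMu_eq_armRate_of_pos` (`μ(y) = β_rot(y)`)).
>
> Source.  N. R. Beaton, J. Phys. A 47 (2014) 075003, arXiv:1210.0274v3, §3.2, Proposition 9 (p. 15): "Moreover, as `T → ∞`,
> `μ_T(1,y) → μ(y)`, where `μ(y)` is as defined in Proposition 7."  (Frame: Beaton's strip of height `T` of the rotated lattice is the
> column slab `Slab_H` of the tree's brick wall, `HexSAWBrickWallSlabFugacity.lean`, whose `slabMuY H y` carries the surface weight on the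
> column `x₀ = 0`, i.e. it is `μ_H(y,1)` in the notation of Proposition 8 (p. 15); the printed sentence is about `μ_T(1,y)`, equal to
> `μ_T(y,1)` by Proposition 8 ("`μ_T(y,z) = μ_T(z,y)`") — that symmetry is NOT proved here, so the statements below are literally about
> the tree's `μ_H(y,1)`.)
>
> ## Main statements (no hypotheses beyond `0 < y`)
>
> * `Arm.slabMuY_le_armRate : 1 ≤ H → μ_H(y) ≤ β_rot(y)`;
> * **`Arm.tendsto_slabMuY : Tendsto (fun H => slabMuY H y) atTop (𝓝 (armRate y))`**;
> * the printed form `μ_T(1,y) → μ(y)` (`HV.rotSurfaceMu`) and the desorbed-window form (`→ μ` for `y ≤ y†`) are NOT restated here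
>   (edition 2): they are `HV.tendsto_slabMuY_rotSurfaceMu_of_pos` / `HV.tendsto_slabMuY_hexConnectiveConstant` of the door-free module
>   `HexSAWRotStripLocalityUniform.lean` (same lineage), which proves them for every `y > 0` without this file's `μ ≤ β_rot(y)`; with
>   `HV.rotSurfaceMu_eq_armRate_of_pos` above the two forms agree.
> EDITIONS: ed.1 40baf884c4ac214d (a-p6 g13); ed.2 (this) = ed.1 with its final `namespace …SAW.HV` block (the two restated limit
> theorems) removed — every other byte unchanged.
-/

noncomputable section

open Filter Function
open Literature.Probability.LatticeModels Literature.Probability.Percolation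
open _root_.Topology
open Literature.Probability.RandomPlanarGeometry.SAW.HexBW.Arm

namespace Literature.Probability.RandomPlanarGeometry.SAW.HV

variable {y : ℝ}

/-- **`μ ≤ β_rot(y)` for every `y > 0`.** [cite: HammersleyTorrieWhittington1982, §2; Beaton2014RotatedHoneycomb, §3.1, proof of Proposition 7 (arXiv v3 p. 12)] -/
theorem hexConnectiveConstant_le_armRate (hy : 0 < y) : hexConnectiveConstant ≤ armRate y :=
  hexConnectiveConstant_le_armRate_of_archBound hy (archBound_holds hy)

/-- **`μ_rot(y) = β_rot(y)` for every `y > 0`.** [cite: Beaton2014RotatedHoneycomb, §3.1, proof of Proposition 7 (arXiv v3 p. 12: "μ(y) = lim U_n^+(y)^{1/n}")] -/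
theorem rotSurfaceMu_eq_armRate_of_pos (hy : 0 < y) : rotSurfaceMu y = armRate y :=
  max_eq_left (hexConnectiveConstant_le_armRate hy)

/-- **Beaton 2014, Proposition 7, first sentence, with the value `β_rot(y)`**: `C⁺_n(y)^{1/n} → β_rot(y)`, the growth rate of the
armchair wall bridges (Beaton's unfolded walks), for every `y > 0`.
[cite: Beaton2014RotatedHoneycomb, §3.1, Proposition 7 (arXiv v3 p. 11) and its proof (p. 12); HammersleyTorrieWhittington1982, §2] -/
theorem tendsto_rotHpCoeff_rpow_armRate (hy : 0 < y) :
    Tendsto (fun n : ℕ => rotHpCoeff n y ^ ((n : ℝ)⁻¹)) atTop (𝓝 (armRate y)) := by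
  rw [← rotSurfaceMu_eq_armRate_of_pos hy]
  exact tendsto_rotHpCoeff_rpow hy

/-- **`β_rot(y) = μ ↔ y ≤ y†`**: the wall-bridge free energy is `log μ` exactly in the desorbed regime.
[cite: Beaton2014RotatedHoneycomb, §3.1, Proposition 7 (arXiv v3 p. 11: "μ(y) = μ if y ≤ y_c, > μ if y > y_c") with Theorem 1 (p. 2: y_c = y†)] -/
theorem armRate_eq_hexConnectiveConstant_iff (hy : 0 < y) : armRate y = hexConnectiveConstant ↔ y ≤ rotYdagger := by
  rw [← rotSurfaceMu_eq_armRate_of_pos hy]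
  exact rotSurfaceMu_eq_iff hy

/-- Numeric instances: `β_rot(1) = β_rot(y†) = μ = √(2+√2)`, `β_rot(2y†) > μ`.
[cite: Beaton2014RotatedHoneycomb, Theorem 1 (arXiv v3 p. 2); DuminilCopinSmirnov2012, Theorem 1] -/
theorem armRate_one : armRate 1 = hexConnectiveConstant ∧ armRate rotYdagger = hexConnectiveConstant ∧
    hexConnectiveConstant < armRate (2 * rotYdagger) :=
  ⟨(armRate_eq_hexConnectiveConstant_iff one_pos).2 one_lt_rotYdagger.le,
   (armRate_eq_hexConnectiveConstant_iff (zero_lt_one.trans one_lt_rotYdagger)).2 le_rfl,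
   (hexConnectiveConstant_lt_armRate_iff (by linarith [zero_lt_one.trans one_lt_rotYdagger])).2
     (by linarith [zero_lt_one.trans one_lt_rotYdagger])⟩

end Literature.Probability.RandomPlanarGeometry.SAW.HV

/-! ## Part 2 (one-car): Beaton 2014, Proposition 9, second sentence, for EVERY `y > 0` — the former `HexSAWRotStripLocalityAllY.lean` -/


open Filter Function
open Literature.Probability.LatticeModels Literature.Probability.Percolation
open _root_.Topology

namespace Literature.Probability.RandomPlanarGeometry.SAW.HexBW.Arm

variable {y : ℝ} {H : ℕ}

/-- **`μ_H(y) ≤ β_rot(y) = μ(y)`** for every strip (`H ≥ 1`, `y > 0`). [cite: Beaton2014RotatedHoneycomb, §3.2, Proposition 9 (arXiv v3 p. 15)] -/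
theorem slabMuY_le_armRate (hy : 0 < y) (hH : 1 ≤ H) : slabMuY H y ≤ armRate y :=
  (slabMuY_le_of_archBound hy (archBound_holds hy) hH).trans_eq (max_eq_left (HV.hexConnectiveConstant_le_armRate hy))

/-- **Beaton 2014, Proposition 9, second sentence, every `y > 0`: `μ_H(y) → β_rot(y)`.**
[cite: Beaton2014RotatedHoneycomb, §3.2, Proposition 9 (arXiv v3 p. 15: "as T → ∞, μ_T(1,y) → μ(y)")] -/
theorem tendsto_slabMuY (hy : 0 < y) : Tendsto (fun H : ℕ => slabMuY H y) atTop (𝓝 (armRate y)) :=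
  tendsto_slabMuY_of_archBound hy (archBound_holds hy) (HV.hexConnectiveConstant_le_armRate hy)

end Literature.Probability.RandomPlanarGeometry.SAW.HexBW.Arm

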